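import Summits.BirchSwinnertonDyer.BirchSwinnertonDyer.Theses.CongruentShaFreeCut
import Summits.BirchSwinnertonDyer.BirchSwinnertonDyer.Theorems.CongruentShaFreeCutGoodPrimes
import Summits.BirchSwinnertonDyer.BirchSwinnertonDyer.Theorems.CongruentShaFreeCutSquarefreeReduction
import Literature.NumberTheory.EllipticCurves.LeadingTerm

/-! # Route `CongruentShaFreeCut` (rung S2) — crux `AnalyticRankOneOfRankOneFiniteShaTwo`
(stmt-BirchSwinnertonDyer-19080) is, modulo refereed facts, a statement about `Ш` ALONE:
«for rank-one `E_n`, finiteness of `Ш[2^∞]` implies finiteness of `Ш`» (no `L`-function in it)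

Crux B reads `∀ n ≠ 0, rank E_n(ℚ) = 1 → #Ш(E_n/ℚ)[2^∞] < ∞ → ord_{s=1} L(E_n, s) = 1` for the
congruent number curves `E_n : y² = x³ − n²x`. This file records, kernel-checked, that modulo three
REFEREED named facts carried as binders — Gross–Zagier–Kolyvagin (`hGZK`, tree fact
`rank_eq_analyticRank_of_analyticRank_le_one`, Darmon CBMS 101 Thm. 3.22), Burungale–Tian, Invent.
Math. 220 (2020) Thm. 1.2 (`hBT`, `burungaleTian_analyticRank_eq_one_of_selmerCorank_eq_one_of_hasCM`)
and Burungale–Kobayashi–Ota, JIMJ 23 (2024) Thm. 1.5 (`hBKO`,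
`BurungaleKobayashiOta2024.thm15_analyticRank_eq_one_of_selmerCorank_eq_one`) — crux B is
EQUIVALENT to each of the following purely ALGEBRAIC transfer statements, in which no `L`-function,
analytic rank or `p`-adic object occurs:

* (T)  `∀ n ≠ 0, rank E_n(ℚ) = 1 → #Ш(E_n/ℚ)[2^∞] < ∞ → #Ш(E_n/ℚ) < ∞`
  (`cruxB_iff_shaFinite_of_shaTwoFinite`; ⇐ needs `hBKO` only, ⇒ needs `hGZK` only);
* (T′) `∀ n square-free, rank E_n(ℚ) = 1 → #Ш(E_n/ℚ)[2^∞] < ∞ → ∃ p prime, p ≥ 5, p ∤ n,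
  #Ш(E_n/ℚ)[p^∞] < ∞` — finiteness of ONE other primary part, at any one prime of good reduction
  `≥ 5` (`cruxB_iff_shaPrimaryTransfer`; ⇐ needs `hBT` + `hBKO` through the landed ladder placement
  `CongruentShaFreeCutGoodPrimes.analyticRank_eq_one_of_rank_eq_one_of_finite_sha_primary_of_five_le`,
  ⇒ needs `hGZK`).

Proofs. (⇐): (T′) hands finiteness of `Ш[p^∞]` at a good prime `p ≥ 5`, where the rank-one
`p`-converse for `E_n` IS refereed print (ordinary `p ≡ 1 (4)`: Burungale–Tian; supersingular
`p ≡ 3 (4)`: BKO via the landed BC5 rung `CongruentShaFreeCutRungSupersingular.stub_rung_supersingular`),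
then the square-free reduction `CongruentShaFreeCutSquarefreeReduction.analyticRankOneOfRankOneFiniteShaTwo_of_squarefree`;
(T) is the landed Ш-finite variant `…SquarefreeReduction.analyticRank_eq_one_of_rank_eq_one_of_finite_sha_of_thm15`.
(⇒): crux B gives `ord_{s=1} L(E_n, s) = 1 ≤ 1`, and Gross–Zagier–Kolyvagin gives `#Ш(E_n/ℚ) < ∞`,
hence every primary part is finite.

WHAT THIS SAYS (numbers, not adjectives; FIND row of D-0074 (I) `bsd-cn100-s2-c3`, generation 2).
The research content of crux B is exactly a `Ш`-PRIMARY TRANSFER for rank-one congruent number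
curves: from the `2`-primary part (the ADDITIVE, ramified-CM prime, where no Iwasawa-theoretic input
is in refereed print) to ANY ONE good prime `p ≥ 5` (where BT20/BKO24 run). No refereed theorem
transfers finiteness between primary parts of `Ш` without passing through `ord_{s=1} L ≤ 1`; the two
claimed proofs (Kriz2020 v5 Thm. 10.13, FanWan2023 v2 Thm. 1.1) do it through a `2`-adic
anticyclotomic main conjecture + Rubin-type formula at the ramified prime, unrefereed. In particular
crux B is implied by (and, for rank-one `E_n` with `Ш[2^∞]` finite, equivalent to) the finiteness of
`Ш(E_n/ℚ)` — so B sits BELOW «rank 1 ⟹ Ш finite» for this family and carries none of the formula.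
Supports, does not close, stmt-BirchSwinnertonDyer-19080; conditional results (named-fact binders),
crediting nothing to the item. -/

namespace Summit.BirchSwinnertonDyer.BirchSwinnertonDyer.Theorems.CongruentShaFreeCutShaPrimaryTransfer

open Literature.NumberTheory.EllipticCurves WeierstrassCurve
open Summit.BirchSwinnertonDyer.BirchSwinnertonDyer.Theses.CongruentShaFreeCut

/-! ### (⇒) Crux B forces finiteness of `Ш(E_n)` (Gross–Zagier–Kolyvagin) -/

/-- **Crux B ⟹ `Ш(E_n/ℚ)` finite** for every `n ≠ 0` with `rank E_n(ℚ) = 1` and `Ш(E_n)[2^∞]`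
finite, modulo Gross–Zagier–Kolyvagin (`hGZK`: `ord_{s=1} L(E, s) ≤ 1 ⟹ rank = ord ∧ #Ш < ∞`):
crux B gives `ord_{s=1} L(E_n, s) = 1`. [cite: Darmon2004, Thm. 3.22 (= Thm. 1.14) and §3.9] -/
theorem shaFinite_of_cruxB (hGZK : rank_eq_analyticRank_of_analyticRank_le_one)
    (hB : AnalyticRankOneOfRankOneFiniteShaTwo) {n : ℕ} (hn : n ≠ 0)
    (hrank : (congruentNumberCurve n).mordellWeilRank = 1)
    (hsha : Finite (AddCommGroup.primaryComponent (congruentNumberCurve n).sha 2)) :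
    Finite (congruentNumberCurve n).sha := by
  haveI := isElliptic_congruentNumberCurve hn
  have h1 : (congruentNumberCurve n).analyticRank = 1 := hB hn hrank hsha
  exact (hGZK (congruentNumberCurve n) (by rw [h1])).2

/-- **Crux B ⟹ (T)**: for rank-one `E_n`, `Ш[2^∞]` finite ⟹ `Ш` finite (modulo `hGZK`).
[cite: Darmon2004, Thm. 3.22 (= Thm. 1.14) and §3.9] -/
theorem shaFinite_of_shaTwoFinite_of_cruxB (hGZK : rank_eq_analyticRank_of_analyticRank_le_one)
    (hB : AnalyticRankOneOfRankOneFiniteShaTwo) :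
    ∀ ⦃n : ℕ⦄, n ≠ 0 → (congruentNumberCurve n).mordellWeilRank = 1 →
      Finite (AddCommGroup.primaryComponent (congruentNumberCurve n).sha 2) →
        Finite (congruentNumberCurve n).sha :=
  fun _ hn hrank hsha => shaFinite_of_cruxB hGZK hB hn hrank hsha

/-- **Crux B ⟹ (T′)**: for square-free `n` with `rank E_n(ℚ) = 1` and `Ш(E_n)[2^∞]` finite there
is a prime `p ≥ 5`, `p ∤ n` (indeed every prime qualifies) with `Ш(E_n)[p^∞]` finite — modulo
`hGZK`. The prime is supplied by Dirichlet (landed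
`CongruentShaFreeCutSquarefreeReduction.exists_prime_five_le_mod_four_eq_three_not_dvd`); the
primary part of a finite group is finite. [cite: Darmon2004, Thm. 3.22 (= Thm. 1.14) and §3.9] -/
theorem shaPrimaryTransfer_of_cruxB (hGZK : rank_eq_analyticRank_of_analyticRank_le_one)
    (hB : AnalyticRankOneOfRankOneFiniteShaTwo) :
    ∀ ⦃n : ℕ⦄, Squarefree n → (congruentNumberCurve n).mordellWeilRank = 1 →
      Finite (AddCommGroup.primaryComponent (congruentNumberCurve n).sha 2) →
        ∃ p : ℕ, p.Prime ∧ 5 ≤ p ∧ ¬ p ∣ n ∧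
          Finite (AddCommGroup.primaryComponent (congruentNumberCurve n).sha p) := by
  intro n hn hrank hsha
  haveI : Finite (congruentNumberCurve n).sha := shaFinite_of_cruxB hGZK hB hn.ne_zero hrank hsha
  obtain ⟨p, hp, hp5, -, hpn⟩ :=
    CongruentShaFreeCutSquarefreeReduction.exists_prime_five_le_mod_four_eq_three_not_dvd hn.ne_zero
  exact ⟨p, hp, hp5, hpn, inferInstance⟩

/-! ### (⇐) The transfer statements give crux B (Burungale–Tian 2020 + BKO 2024) -/

/-- **(T′) ⟹ crux B** modulo Burungale–Tian 2020 Thm. 1.2 (`hBT`) and BKO 2024 Thm. 1.5 (`hBKO`):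
for square-free `n` the transfer hands a good prime `p ≥ 5`, `p ∤ n`, with `Ш(E_n)[p^∞]` finite, where
the rank-one Ш-finite `p`-converse for `E_n` is the landed ladder placement
`CongruentShaFreeCutGoodPrimes.analyticRank_eq_one_of_rank_eq_one_of_finite_sha_primary_of_five_le`
(ordinary `p ≡ 1 (4)` via `hBT`, supersingular `p ≡ 3 (4)` via the BC5 rung and `hBKO`); general
`n ≠ 0` by the square-free reduction
`CongruentShaFreeCutSquarefreeReduction.analyticRankOneOfRankOneFiniteShaTwo_of_squarefree`.
[cite: BurungaleTian2019, Thm. 1.2 (p. 214)]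
[cite: BurungaleKobayashiOta2023, Thm. 1.5 (JIMJ 23 (2024), p. 1422)] -/
theorem cruxB_of_shaPrimaryTransfer
    (hBT : burungaleTian_analyticRank_eq_one_of_selmerCorank_eq_one_of_hasCM)
    (hBKO : BurungaleKobayashiOta2024.thm15_analyticRank_eq_one_of_selmerCorank_eq_one)
    (hT : ∀ ⦃n : ℕ⦄, Squarefree n → (congruentNumberCurve n).mordellWeilRank = 1 →
      Finite (AddCommGroup.primaryComponent (congruentNumberCurve n).sha 2) →
        ∃ p : ℕ, p.Prime ∧ 5 ≤ p ∧ ¬ p ∣ n ∧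
          Finite (AddCommGroup.primaryComponent (congruentNumberCurve n).sha p)) :
    AnalyticRankOneOfRankOneFiniteShaTwo := by
  refine CongruentShaFreeCutSquarefreeReduction.analyticRankOneOfRankOneFiniteShaTwo_of_squarefree ?_
  intro n hn hrank hsha
  obtain ⟨p, hp, hp5, hpn, hfin⟩ := hT hn hrank hsha
  haveI : Fact p.Prime := ⟨hp⟩
  exact CongruentShaFreeCutGoodPrimes.analyticRank_eq_one_of_rank_eq_one_of_finite_sha_primary_of_five_le
    hBT hBKO hn hp5 hpn hrank hfin

/-- **(T) ⟹ crux B** modulo BKO 2024 Thm. 1.5 ALONE (`hBKO`): the transfer makes `Ш(E_n)` finite,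
and «`rank E_n(ℚ) = 1 ∧ #Ш(E_n/ℚ) < ∞ ⟹ ord_{s=1} L(E_n, s) = 1`» is the landed Ш-finite variant
`CongruentShaFreeCutSquarefreeReduction.analyticRank_eq_one_of_rank_eq_one_of_finite_sha_of_thm15`
(Dirichlet prime `p ≡ 3 (4)`, `p ≥ 5`, `p ∤ n` + the BC5 rung).
[cite: BurungaleKobayashiOta2023, Thm. 1.5 (JIMJ 23 (2024), p. 1422)] -/
theorem cruxB_of_shaFinite_of_shaTwoFinite
    (hBKO : BurungaleKobayashiOta2024.thm15_analyticRank_eq_one_of_selmerCorank_eq_one)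
    (hT : ∀ ⦃n : ℕ⦄, n ≠ 0 → (congruentNumberCurve n).mordellWeilRank = 1 →
      Finite (AddCommGroup.primaryComponent (congruentNumberCurve n).sha 2) →
        Finite (congruentNumberCurve n).sha) :
    AnalyticRankOneOfRankOneFiniteShaTwo :=
  fun _ hn hrank hsha =>
    CongruentShaFreeCutSquarefreeReduction.analyticRank_eq_one_of_rank_eq_one_of_finite_sha_of_thm15
      hBKO hn hrank (hT hn hrank hsha)

/-! ### The equivalences -/

/-- **Crux B ⟺ (T)** modulo `hGZK` (⇒) and `hBKO` (⇐): for rank-one congruent number curves, «`Ш[2^∞]`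
finite ⟹ `ord_{s=1} L = 1`» is the same statement as «`Ш[2^∞]` finite ⟹ `Ш` finite». Crux B's content
is a `Ш`-primary TRANSFER out of the additive prime `2`; no `L`-function survives on the right.
[cite: Darmon2004, Thm. 3.22 (= Thm. 1.14) and §3.9]
[cite: BurungaleKobayashiOta2023, Thm. 1.5 (JIMJ 23 (2024), p. 1422)] -/
theorem cruxB_iff_shaFinite_of_shaTwoFinite (hGZK : rank_eq_analyticRank_of_analyticRank_le_one)
    (hBKO : BurungaleKobayashiOta2024.thm15_analyticRank_eq_one_of_selmerCorank_eq_one) :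
    AnalyticRankOneOfRankOneFiniteShaTwo ↔
      ∀ ⦃n : ℕ⦄, n ≠ 0 → (congruentNumberCurve n).mordellWeilRank = 1 →
        Finite (AddCommGroup.primaryComponent (congruentNumberCurve n).sha 2) →
          Finite (congruentNumberCurve n).sha :=
  ⟨shaFinite_of_shaTwoFinite_of_cruxB hGZK, cruxB_of_shaFinite_of_shaTwoFinite hBKO⟩

/-- **Crux B ⟺ (T′)** modulo `hGZK` (⇒) and `hBT` + `hBKO` (⇐): for rank-one square-free `E_n`,
«`Ш[2^∞]` finite ⟹ `ord_{s=1} L = 1`» is the same statement as «`Ш[2^∞]` finite ⟹ `Ш[p^∞]` finite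
for SOME good prime `p ≥ 5`». [cite: Darmon2004, Thm. 3.22 (= Thm. 1.14) and §3.9]
[cite: BurungaleTian2019, Thm. 1.2 (p. 214)]
[cite: BurungaleKobayashiOta2023, Thm. 1.5 (JIMJ 23 (2024), p. 1422)] -/
theorem cruxB_iff_shaPrimaryTransfer (hGZK : rank_eq_analyticRank_of_analyticRank_le_one)
    (hBT : burungaleTian_analyticRank_eq_one_of_selmerCorank_eq_one_of_hasCM)
    (hBKO : BurungaleKobayashiOta2024.thm15_analyticRank_eq_one_of_selmerCorank_eq_one) :
    AnalyticRankOneOfRankOneFiniteShaTwo ↔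
      ∀ ⦃n : ℕ⦄, Squarefree n → (congruentNumberCurve n).mordellWeilRank = 1 →
        Finite (AddCommGroup.primaryComponent (congruentNumberCurve n).sha 2) →
          ∃ p : ℕ, p.Prime ∧ 5 ≤ p ∧ ¬ p ∣ n ∧
            Finite (AddCommGroup.primaryComponent (congruentNumberCurve n).sha p) :=
  ⟨shaPrimaryTransfer_of_cruxB hGZK, cruxB_of_shaPrimaryTransfer hBT hBKO⟩

/-- **(T) and (T′) are equivalent to each other** modulo the three facts (both are crux B): the
one-prime transfer at any good `p ≥ 5` already forces finiteness of all of `Ш` for rank-one `E_n`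
with `Ш[2^∞]` finite. [cite: Darmon2004, Thm. 3.22 (= Thm. 1.14) and §3.9]
[cite: BurungaleTian2019, Thm. 1.2 (p. 214)]
[cite: BurungaleKobayashiOta2023, Thm. 1.5 (JIMJ 23 (2024), p. 1422)] -/
theorem shaFinite_transfer_iff_shaPrimaryTransfer
    (hGZK : rank_eq_analyticRank_of_analyticRank_le_one)
    (hBT : burungaleTian_analyticRank_eq_one_of_selmerCorank_eq_one_of_hasCM)
    (hBKO : BurungaleKobayashiOta2024.thm15_analyticRank_eq_one_of_selmerCorank_eq_one) :
    (∀ ⦃n : ℕ⦄, n ≠ 0 → (congruentNumberCurve n).mordellWeilRank = 1 →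
        Finite (AddCommGroup.primaryComponent (congruentNumberCurve n).sha 2) →
          Finite (congruentNumberCurve n).sha) ↔
      ∀ ⦃n : ℕ⦄, Squarefree n → (congruentNumberCurve n).mordellWeilRank = 1 →
        Finite (AddCommGroup.primaryComponent (congruentNumberCurve n).sha 2) →
          ∃ p : ℕ, p.Prime ∧ 5 ≤ p ∧ ¬ p ∣ n ∧
            Finite (AddCommGroup.primaryComponent (congruentNumberCurve n).sha p) := by
  rw [← cruxB_iff_shaFinite_of_shaTwoFinite hGZK hBKO, cruxB_iff_shaPrimaryTransfer hGZK hBT hBKO]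

end Summit.BirchSwinnertonDyer.BirchSwinnertonDyer.Theorems.CongruentShaFreeCutShaPrimaryTransfer
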